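import Summits.AtomisticToContinuum.Crystallization.Theorems.FrustratedLawDichotomyCellKitF

/-!
# FrustratedLawDichotomy · crux `AperiodicFrustratedLawGap` (stmt-AtomisticToContinuum-27623) — CELL CERTIFICATE CHECKER:
# a kernel-evaluable checker whose acceptance discharges EVERY hypothesis of the periodic-block negative kernel
# (decomp-a2c, prover hand 1, generation 15; critic row 564 (i))

A RATIONAL PERIODIC CELL is `Cell` = common denominator `DEN`, motif numerators `X : Fin N₀ → ℤ³`, cell numerators `A : Fin 3 → ℤ³`, an integer
adjugate `Bz` with scale `bs` (dual basis `b_j = bs • Bz_j`), the bounds `cB ≥ ‖b_j‖`, `Dq ≥ diam`, the separation scan radius `S₀` and the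
supercell half-width `k₀`.  Its real objects are `Cell.x m = X m / DEN`, `Cell.a k = A k / DEN`, `Cell.b`, and the supercell motif of
`…PeriodicBlockKernel.superMotif` under the enumeration `cellμ / cellσ / cellIdx` of part F is `q ↦ ptZ (μ q) (digits q) / DEN` (`superMotif_eq`).

A CLASS CERTIFICATE `ClassCert` = nearest-neighbour squared numerator `Qn` with its integer square-root `s` at precision `sqrtPrec`, an nn witness,
a FAR witness (radius in `[21/20·d, 13/10·d)`), the orientation sign `eps` and the assignment `asg` of the twelve `hcpTab` vectors to supercell
points, and a claimed rational upper bound `Ub` of the class site sum `Σ_q W₄₅(|x_m − superMotif q|)`.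

The Boolean checks (`checkGeom`, `checkClass`) are plain structural recursions (`allBelow`, `sumBelow`) and `Fin`-quantified `decide`s in
`ℤ`/`ℚ` (measured: one class of the 16-atom, `k₀ = 4` witness ≈ 27 s of `decide +kernel`); the term bound `ubTerm` (self term `−3/200`, `0` out
of range, `ubW` at a verified square-root enclosure rounded up to denominator `2^40`, unconditional fallback `r⁻¹²/12`) is proved sound here
(`effPot_le_ubTerm`).  The soundness of the checks — producing the kernel hypotheses verbatim and ★ `not_schurElasticPricing_fourHalf_of_check`
— is the sibling `…CellCheckerSound`; the DATA (hand-1 g14's all-strained hcp 2×2×2 witness in the hcp frame) and the `decide` calls live in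
`…CellEflatCeiling`.  All `[folklore]`; 0 sorry.
-/

namespace Summit.AtomisticToContinuum.Crystallization.Theorems.FrustratedLawDichotomyCellChecker

open scoped BigOperators RealInnerProductSpace
open Literature.Geometry.DiscreteGeometry (intVec sqNormInt norm_intVec intVec_sub intVec_apply intVec_add intVec_zsmul inner_intVec dotInt
  hcpKissingPattern hcpTab hcpTab_injective scaledPattern_map_injective sqNormInt_hcpInt hcpInt_eq_image)
open Literature.MathematicalPhysics.StatisticalMechanics (lennardJones)
open Summit.AtomisticToContinuum.Crystallization.Theorems.ChargedEnergyGapNegative (E3)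
open Summit.AtomisticToContinuum.Crystallization.Theorems.FrustratedLawDichotomyRangeCut (GoodAt Sep)
open Summit.AtomisticToContinuum.Crystallization.Theorems.FrustratedLawDichotomyMotifLemmas (GoodAtScale)
open Summit.AtomisticToContinuum.Crystallization.Theorems.FrustratedLawDichotomyMotifDoorE (MaybeGoodAt)
open Summit.AtomisticToContinuum.Crystallization.Theorems.FrustratedLawDichotomySchurCut
open Summit.AtomisticToContinuum.Crystallization.Theorems.FrustratedLawDichotomyPeriodicBlockGeometry (latVec abs_coord_le_of_dual')
open Summit.AtomisticToContinuum.Crystallization.Theorems.FrustratedLawDichotomyPeriodicBlockKernel (superMotif PerSep DiamLE)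
open Summit.AtomisticToContinuum.Crystallization.Theorems.FrustratedLawDichotomyPeriodicBlockViolation (not_schurElasticPricing_of_cell)
open Summit.AtomisticToContinuum.Crystallization.Theorems.FrustratedLawDichotomyCellKitW
open Summit.AtomisticToContinuum.Crystallization.Theorems.FrustratedLawDichotomyCellKitF

/-! ## §1. Data -/

/-- A rational periodic cell with its dual-basis and bookkeeping constants. -/
structure Cell where
  /-- common denominator -/
  DEN : ℕ
  /-- number of classes (motif size) -/
  N₀ : ℕ
  /-- supercell half-width -/
  k₀ : ℕ
  /-- motif numerators -/
  X : Fin N₀ → Fin 3 → ℤ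
  /-- cell numerators -/
  A : Fin 3 → Fin 3 → ℤ
  /-- integer directions of the dual basis -/
  Bz : Fin 3 → Fin 3 → ℤ
  /-- scale of the dual basis -/
  bs : ℚ
  /-- bound on the dual basis norms -/
  cB : ℚ
  /-- bound on the motif diameter -/
  Dq : ℚ
  /-- separation scan radius -/
  S₀ : ℕ

/-- A class certificate (see the module docstring). -/
structure ClassCert (N₀ K3 : ℕ) where
  /-- nearest-neighbour squared numerator -/
  Qn : ℕ
  /-- `isqrt (Qn * sqrtPrec²)` -/
  s : ℕ
  /-- nearest-neighbour witness -/
  nn : Fin N₀ × Fin K3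
  /-- far witness -/
  far : Fin N₀ × Fin K3
  /-- orientation: `true` = `+id`, `false` = `−id` -/
  eps : Bool
  /-- assignment of the twelve `hcpTab` vectors -/
  asg : Fin 12 → Fin N₀ × Fin K3
  /-- claimed upper bound of the class site sum -/
  Ub : ℚ

namespace Cell

variable (c : Cell)

/-- `K = 2k₀ + 1`. -/
def K : ℕ := 2 * c.k₀ + 1
/-- `K³`. -/
abbrev K3 : ℕ := (2 * c.k₀ + 1) ^ 3
/-- The motif. -/
noncomputable def x : Fin c.N₀ → E3 := fun m => qpt c.DEN (c.X m)
/-- The cell basis. -/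
noncomputable def a : Fin 3 → E3 := fun k => qpt c.DEN (c.A k)
/-- The dual basis. -/
noncomputable def b : Fin 3 → E3 := fun j => (c.bs : ℝ) • intVec (c.Bz j)
/-- Numerators of the supercell point `(m', t)`. -/
def ptZ (m' : Fin c.N₀) (t : Fin c.K3) : Fin 3 → ℤ := c.X m' + latZ c.A (cellDigits c.k₀ t)
/-- Kernel-evaluable twin of `ptZ` on a raw digit index. -/
def ptN (m' : Fin c.N₀) (t : ℕ) : Fin 3 → ℤ :=
  c.X m' + latZ c.A (fun k => (((t / (2 * c.k₀ + 1) ^ (k : ℕ) % (2 * c.k₀ + 1) : ℕ) : ℤ) - c.k₀))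
/-- Squared numerator distance from the class centre `m` to the supercell point `(m', t)`. -/
def nN (m m' : Fin c.N₀) (t : ℕ) : ℤ := sqNormInt (c.ptN m' t - c.X m)

/-- `ptZ` agrees with its kernel-evaluable twin. [folklore] -/
theorem ptZ_eq_ptN (m' : Fin c.N₀) (t : Fin c.K3) : c.ptZ m' t = c.ptN m' t := by
  unfold ptZ ptN
  rw [show cellDigits c.k₀ t = (fun k : Fin 3 => (((t / (2 * c.k₀ + 1) ^ (k : ℕ) % (2 * c.k₀ + 1) : ℕ) : ℤ) - c.k₀)) from
    funext (cellDigits_val c.k₀ t)]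

/-- ★ The supercell motif of the kernel, under the enumeration of part F, is `q ↦ ptZ / DEN`. [folklore] -/
theorem superMotif_eq (q : Fin (c.N₀ * (2 * c.k₀ + 1) ^ 3)) :
    superMotif c.x c.a (cellμ c.N₀ c.k₀) (cellσ c.N₀ c.k₀) q = qpt c.DEN (c.ptZ (cellμ c.N₀ c.k₀ q) (finProdFinEquiv.symm q).2) := by
  simp only [superMotif, Cell.x, ptZ, cellσ_eq]
  rw [show c.a = (fun k => qpt c.DEN (c.A k)) from rfl, latVec_qpt, qpt_add]

/-- Distance from the class centre to a supercell point. [folklore] -/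
theorem dist_superMotif_centre (hc : 0 < c.DEN) (m : Fin c.N₀) (q : Fin (c.N₀ * (2 * c.k₀ + 1) ^ 3)) :
    dist (superMotif c.x c.a (cellμ c.N₀ c.k₀) (cellσ c.N₀ c.k₀) q) (c.x m) =
      ((c.DEN : ℝ))⁻¹ * Real.sqrt (c.nN m (cellμ c.N₀ c.k₀ q) (finProdFinEquiv.symm q).2 : ℝ) := by
  rw [superMotif_eq, x, dist_qpt hc, ptZ_eq_ptN]; rfl

/-- The class centre is the supercell point `cellIdx m`. [folklore] -/
theorem superMotif_cellIdx (m : Fin c.N₀) : superMotif c.x c.a (cellμ c.N₀ c.k₀) (cellσ c.N₀ c.k₀) (cellIdx c.N₀ c.k₀ m) = c.x m := by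
  simp only [superMotif, (cellIdx_spec c.N₀ c.k₀ m).1, (cellIdx_spec c.N₀ c.k₀ m).2,
    FrustratedLawDichotomyPeriodicBlockGeometry.latVec_zero, add_zero]

end Cell

/-! ## §2. Kernel-evaluable arithmetic: integer square roots, rounding up, the term bound -/

/-- Precision factor of the square-root enclosures (`10⁵`: width `1/(DEN·10⁵)`). -/
def sqrtPrec : ℕ := 100000

/-- Newton iteration with fuel (the result is only used through the check `s² ≤ n < (s+1)²`). -/
def isqrtAux : ℕ → ℕ → ℕ → ℕ
  | 0, _, g => g
  | fuel + 1, n, g => if g = 0 then 0 else if (g + n / g) / 2 < g then isqrtAux fuel n ((g + n / g) / 2) else g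

/-- Bit length with fuel (structural). -/
def bitlenAux : ℕ → ℕ → ℕ
  | 0, _ => 0
  | fuel + 1, n => if n = 0 then 0 else bitlenAux fuel (n / 2) + 1

/-- Integer square-root candidate: Newton from the power of two `2^(⌊L/2⌋+1) ≥ √n`, `L` the bit length. -/
def isqrt (n : ℕ) : ℕ := isqrtAux 64 n (2 ^ (bitlenAux 400 n / 2 + 1))

/-- Round a rational UP to denominator `2^40`. -/
def roundUp (q : ℚ) : ℚ := (⌈q * 2 ^ 40⌉ : ℚ) / 2 ^ 40

/-- Rounding up does not decrease. [folklore] -/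
theorem le_roundUp (q : ℚ) : q ≤ roundUp q := by
  unfold roundUp
  rw [le_div_iff₀ (by positivity)]
  exact Int.le_ceil _

/-- **The certified upper bound of one site-sum term** `W₄₅(√n / DEN)` (`n` = squared numerator distance): the self term `n = 0` is `W₄₅(0) = −3/200`;
out of range (`n ≥ (9/2)²·DEN²`) it is `0`; otherwise `ubW` at the verified enclosure, rounded up; if the enclosure check fails, the unconditional
bound `r⁻¹²/12`. -/
def ubTerm (DEN : ℕ) (n : ℕ) : ℚ :=
  if n = 0 then -(3 / 200) else
    if 81 * DEN ^ 2 ≤ 4 * n then 0 else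
      if isqrt (n * sqrtPrec ^ 2) ^ 2 ≤ n * sqrtPrec ^ 2 ∧ n * sqrtPrec ^ 2 < (isqrt (n * sqrtPrec ^ 2) + 1) ^ 2 then
        roundUp (ubW ((n : ℚ) / (DEN : ℚ) ^ 2) ((isqrt (n * sqrtPrec ^ 2) : ℚ) / (DEN * sqrtPrec))
          (((isqrt (n * sqrtPrec ^ 2) : ℚ) + 1) / (DEN * sqrtPrec)))
      else 1 / 12 * (((DEN : ℚ) ^ 2) / n) ^ 6

/-- ★ Soundness of the term bound: `W₄₅(DEN⁻¹·√n) ≤ ubTerm DEN n`. [folklore] -/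
theorem effPot_le_ubTerm {DEN : ℕ} (hD : 0 < DEN) (n : ℕ) :
    effPot w₄₅ ω₄ (3 / 400) (((DEN : ℝ))⁻¹ * Real.sqrt n) ≤ (ubTerm DEN n : ℝ) := by
  have hD' : (0 : ℝ) < DEN := by exact_mod_cast hD
  have hr : 0 ≤ ((DEN : ℝ))⁻¹ * Real.sqrt n := by positivity
  have hr2 : (((DEN : ℝ))⁻¹ * Real.sqrt n) ^ 2 = (n : ℝ) / (DEN : ℝ) ^ 2 := by
    rw [mul_pow, Real.sq_sqrt (Nat.cast_nonneg n), inv_pow]; field_simp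
  unfold ubTerm
  split_ifs with h0 h81 hs
  · subst h0
    simp [effPot_fourHalf_zero]
  · -- out of range: `r ≥ 9/2`
    have h92 : 9 / 2 ≤ ((DEN : ℝ))⁻¹ * Real.sqrt n := by
      have h : ((9 : ℝ) / 2) ^ 2 ≤ (((DEN : ℝ))⁻¹ * Real.sqrt n) ^ 2 := by
        rw [hr2, le_div_iff₀ (by positivity)]
        have : (81 : ℝ) * (DEN : ℝ) ^ 2 ≤ 4 * n := by exact_mod_cast h81
        linarith
      exact (pow_le_pow_iff_left₀ (by norm_num) hr two_ne_zero).1 h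
    rw [effPot_fourHalf_eq_zero _ h92]; simp
  · -- the certified branch
    set s := isqrt (n * sqrtPrec ^ 2) with hs_def
    have hn : 0 < n := Nat.pos_of_ne_zero h0
    have hDq : (0 : ℚ) < DEN := by exact_mod_cast hD
    have hPq : (0 : ℚ) < sqrtPrec := by unfold sqrtPrec; norm_num
    have h1 : ((s : ℚ)) ^ 2 ≤ (n : ℚ) * (sqrtPrec : ℚ) ^ 2 := by exact_mod_cast hs.1
    have h2 : (n : ℚ) * (sqrtPrec : ℚ) ^ 2 ≤ ((s : ℚ) + 1) ^ 2 := by exact_mod_cast hs.2.le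
    refine le_trans ?_ (Rat.cast_le.2 (le_roundUp _))
    refine effPot_le_ubW hr ?_ (by positivity) (by positivity) (by positivity) ?_ ?_
    · rw [hr2, Rat.cast_div, Rat.cast_pow, Rat.cast_natCast, Rat.cast_natCast]
    · rw [div_pow, mul_pow, div_le_div_iff₀ (by positivity) (by positivity)]
      nlinarith [h1, hDq, hPq]
    · rw [div_pow, mul_pow, div_le_div_iff₀ (by positivity) (by positivity)]
      nlinarith [h2, hDq, hPq]
  · -- the unconditional branch `W ≤ r⁻¹²/12`
    have hn : 0 < n := Nat.pos_of_ne_zero h0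
    set r : ℝ := ((DEN : ℝ))⁻¹ * Real.sqrt n with hr_def
    have hr0 : 0 < r := by rw [hr_def]; exact mul_pos (inv_pos.2 hD') (Real.sqrt_pos.2 (by exact_mod_cast hn))
    have hw := FrustratedLawDichotomyAveragingCut.w₄₅_mem r
    have hω : 0 ≤ ω₄ r := FrustratedLawDichotomyBumpAutocorrelation.omega₂_nonneg (by positivity)
    have hV : lennardJones r ≤ 1 / 12 * (r⁻¹) ^ 12 := by
      unfold lennardJones
      have : (0 : ℝ) ≤ (r⁻¹) ^ 6 := by positivity
      linarith
    have hcast : ((1 / 12 * (((DEN : ℚ) ^ 2) / n) ^ 6 : ℚ) : ℝ) = 1 / 12 * (r⁻¹) ^ 12 := by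
      push_cast
      rw [show (r⁻¹) ^ 12 = ((r ^ 2)⁻¹) ^ 6 by rw [inv_pow, inv_pow, ← pow_mul], hr2, inv_div]
    rw [hcast]
    unfold effPot corePot
    have h12 : (0 : ℝ) ≤ (r⁻¹) ^ 12 := by positivity
    rcases le_or_gt 0 (lennardJones r) with hV0 | hV0
    · nlinarith [hw.1, hw.2]
    · nlinarith [hw.1, hw.2]

/-! ## §3. Kernel-cheap loops over `ℕ` -/

/-- `allBelow f n = f 0 && … && f (n−1)` by structural recursion. -/
def allBelow (f : ℕ → Bool) : ℕ → Bool
  | 0 => true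
  | n + 1 => f n && allBelow f n

/-- `sumBelow f n = f 0 + … + f (n−1)` by structural recursion. -/
def sumBelow (f : ℕ → ℚ) : ℕ → ℚ
  | 0 => 0
  | n + 1 => sumBelow f n + f n

/-- `allBelow f n` certifies `f t` for every `t < n`. [folklore] -/
theorem allBelow_spec {f : ℕ → Bool} {n : ℕ} (h : allBelow f n = true) : ∀ t, t < n → f t = true := by
  induction n with
  | zero => intro t ht; omega
  | succ n ih =>
    intro t ht
    simp only [allBelow, Bool.and_eq_true] at h
    rcases Nat.lt_succ_iff_lt_or_eq.1 ht with hlt | rfl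
    · exact ih h.2 t hlt
    · exact h.1

/-- `sumBelow f n = Σ_{t < n} f t`. [folklore] -/
theorem sumBelow_eq (f : ℕ → ℚ) (n : ℕ) : sumBelow f n = ∑ t ∈ Finset.range n, f t := by
  induction n with
  | zero => simp [sumBelow]
  | succ n ih => rw [sumBelow, ih, Finset.sum_range_succ]

/-! ## §3. The checks -/

namespace Cell

variable (c : Cell)

/-- The cube `[−S, S]³` as a list of integer vectors (digits of `u < (2S+1)³`). -/
def cubeList (S : ℕ) : List (Fin 3 → ℤ) :=
  (List.range ((2 * S + 1) ^ 3)).map fun u k => (((u / (2 * S + 1) ^ (k : ℕ) % (2 * S + 1) : ℕ) : ℤ) - S)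

/-- GEOMETRY CHECK: `0 < DEN`, `1 ≤ N₀`, `0 < cB`, `0 ≤ Dq`, the dual basis (`bs·⟪Bz_j, A_k⟫ = DEN·δ_jk`), its norm bound (`bs²|Bz_j|² ≤ cB²`),
the diameter bound (`|X_m − X_m'|² ≤ Dq²·DEN²`), `cB(9/2 + Dq) < k₀ + 1`, the far-translation condition `cB·(Dq + 7/10) ≤ S₀ + 1` and the
separation scan `|X_m − X_m' − latZ A s|² ≥ (7/10)²·DEN²` over `|s|_∞ ≤ S₀`, `(m, s) ≠ (m', 0)`. -/
def checkGeom : Bool :=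
  decide (0 < c.DEN) && decide (1 ≤ c.N₀) && decide (0 < c.cB) && decide (0 ≤ c.Dq) &&
  decide (∀ j k : Fin 3, c.bs * (dotInt (c.Bz j) (c.A k) : ℚ) = if j = k then (c.DEN : ℚ) else 0) &&
  decide (∀ j : Fin 3, c.bs ^ 2 * (sqNormInt (c.Bz j) : ℚ) ≤ c.cB ^ 2) &&
  decide (∀ m m' : Fin c.N₀, (sqNormInt (c.X m - c.X m') : ℚ) ≤ c.Dq ^ 2 * (c.DEN : ℚ) ^ 2) &&
  decide (c.cB * (9 / 2 + c.Dq) < c.k₀ + 1) &&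
  decide (c.cB * (c.Dq + 7 / 10) ≤ c.S₀ + 1) &&
  decide (∀ m m' : Fin c.N₀, ∀ s ∈ cubeList c.S₀, (m = m' ∧ s = 0) ∨ 49 * (c.DEN : ℤ) ^ 2 ≤ 100 * sqNormInt (c.X m - c.X m' - latZ c.A s))

/-- Tolerance of the `1/8`-fit actually certified (`η = 1249/10000 < 1/8`). -/
def etaFit : ℚ := 1249 / 10000
/-- Gap of the clean shell (`γ = 1/50`). -/
def gam : ℚ := 1 / 50

/-- Lower end of the enclosure of the nearest-neighbour distance of a class. -/
def loOf (C : ClassCert c.N₀ c.K3) : ℚ := (C.s : ℚ) / (c.DEN * sqrtPrec)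
/-- Upper end of the enclosure of the nearest-neighbour distance of a class. -/
def hiOf (C : ClassCert c.N₀ c.K3) : ℚ := ((C.s : ℚ) + 1) / (c.DEN * sqrtPrec)
/-- Integer threshold above which a point is outside the clean gap: `⌈(13/10·hi + γ)²·DEN²⌉`. -/
def thrOut (C : ClassCert c.N₀ c.K3) : ℤ := ⌈(13 / 10 * c.hiOf C + gam) ^ 2 * (c.DEN : ℚ) ^ 2⌉
/-- Integer threshold below which a point is inside the clean shell: `⌊(13/10·lo − γ)²·DEN²⌋`. -/
def thrIn (C : ClassCert c.N₀ c.K3) : ℤ := ⌊(13 / 10 * c.loOf C - gam) ^ 2 * (c.DEN : ℚ) ^ 2⌋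
/-- The orientation sign as an integer. -/
def sgnOf (C : ClassCert c.N₀ c.K3) : ℤ := if C.eps then 1 else -1

/-- The per-point test of the scan (`n` = squared numerator distance to the centre). -/
def scanPt (Q TO TI : ℤ) (hit : Bool) (n : ℤ) : Bool :=
  decide (n = 0) || (decide (Q ≤ n) && (decide (TO ≤ n) || (decide (n ≤ TI) && hit)))

/-- CLASS CHECK for class `m` with certificate `C`: nearest neighbour (`n(nn) = Qn > 0`, `Qn ≤ 4·DEN²`), far witness
(`441·Qn ≤ 400·n(far) < 676·Qn`... i.e. radius in `[21/20·d, 13/10·d)`), the square-root enclosure of `Qn`, `13/10·lo − γ ≥ 0`, the fit of the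
twelve assigned points (`G = ε⟪V, h_i⟫ ≥ 0`, `(|V|² + Qn(1−η²))²·18 ≤ 4·Qn·G²`), the full scan (pinning + clean shell + assignment hits) and the
class site-sum bound `Σ_{m', t} ubTerm(n) ≤ Ub`. -/
def checkClass (m : Fin c.N₀) (C : ClassCert c.N₀ c.K3) : Bool :=
  decide (0 < C.Qn) &&
  decide (c.nN m C.nn.1 C.nn.2 = C.Qn) &&
  decide ((C.Qn : ℚ) ≤ 4 * (c.DEN : ℚ) ^ 2) &&
  decide (441 * (C.Qn : ℤ) ≤ 400 * c.nN m C.far.1 C.far.2 ∧ 100 * c.nN m C.far.1 C.far.2 < 169 * (C.Qn : ℤ)) &&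
  decide (C.s ^ 2 ≤ C.Qn * sqrtPrec ^ 2 ∧ C.Qn * sqrtPrec ^ 2 < (C.s + 1) ^ 2) &&
  decide (0 ≤ 13 / 10 * c.loOf C - gam) &&
  decide (∀ i : Fin 12, 0 ≤ c.sgnOf C * dotInt (c.ptN (C.asg i).1 (C.asg i).2 - c.X m) (hcpTab i) ∧
    ((sqNormInt (c.ptN (C.asg i).1 (C.asg i).2 - c.X m) : ℚ) + (C.Qn : ℚ) * (1 - etaFit ^ 2)) ^ 2 * 18 ≤
      4 * (C.Qn : ℚ) * ((c.sgnOf C * dotInt (c.ptN (C.asg i).1 (C.asg i).2 - c.X m) (hcpTab i) : ℤ) : ℚ) ^ 2) &&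
  decide (∀ m' : Fin c.N₀, allBelow (fun t =>
    scanPt C.Qn (c.thrOut C) (c.thrIn C) (decide (∃ i : Fin 12, (C.asg i).1 = m' ∧ ((C.asg i).2 : ℕ) = t)) (c.nN m m' t)) c.K3 = true) &&
  decide ((∑ m' : Fin c.N₀, sumBelow (fun t => ubTerm c.DEN (c.nN m m' t).toNat) c.K3) ≤ C.Ub)

end Cell

end Summit.AtomisticToContinuum.Crystallization.Theorems.FrustratedLawDichotomyCellChecker
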